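import Summits.CriticalPhenomena.CardyFormulaZ2.Theorems.ParafermionPrecompact.Negative.ParafermionPrecompactFalseOfBulkNondegenerate
import Summits.CriticalPhenomena.CardyFormulaZ2.Theorems.CardyComplexConeEdgePrecompactIpExact

/-!
# Line `rs-meander-strip-profile` for the crux `CardySusyWard.ParafermionPrecompact`
(item stmt-CriticalPhenomena-11293) — CHECKED **REFUTATION** SKELETON (crux-plan, round 1, gen 2)

Planners `planner-cruxplan-stmt-CriticalPhenomena-11293-rs-meander-strip-pro-0` (gen 1, 6 stubs) and
`…-rs-meander-strip-pro-g2-0` (gen 2, this file: 7 stubs, the Ikhlef–Ponsaing calibration split into the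
named Literature fact and a provable-now Γ-bound), 2026-08-16. Idea card
`Cruxes/ParafermionPrecompact/Ideas/rs-meander-strip-profile.md` (crux-ideate r1, ideator 1); triage
r1-1/2/3: pass ×3 ("calibration line, not a closing line"; "the one line that can land ¬(rev-5 decl), via
H"). Line card: `Lines/rs-meander-strip-profile.md`.

## Status for the lead and the disprover (READ FIRST)

**No theorem of this file concludes the route decl `Theses.CardySusyWard.ParafermionPrecompact`, and no
honest file can.** The crux AS TYPED (route file rev 5) is, kernel-checked, the NEGATION of the bulk
non-degeneracy `H = Literature.Probability.LatticeModels.ParafermionBulkNondegenerate` of the `q = 1`,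
spin-`1/3` parafermion (`Negative.parafermionPrecompact_iff_not_bulkNondegenerate`, p74235; Disproof.lean
§3–4; six refuter certificates; all three triagers): clause (ii) quantifies `z z'` over all of
`MedialVertex = Sym2 (Site 2)` and the junk twins collapse it to "`δ^{-1/3} F_δ → 0` on compacts". `H` is
the weakest consequence of DCS 2012 Conjecture 8.7 — the conjecture the route sets out to prove — so a
`ParafermionPrecompact_of : stubs → ParafermionPrecompact` with TRUE stubs does not exist; the default
`ledger skeleton check … --crux stmt-CriticalPhenomena-11293` on this file reports `skeleton.missing`, by
design (crux-plan outcome `no-skeleton` AS A PROOF LINE). This line's deliverable is exactly `H`, for ONE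
explicit family (long DIAGONAL rectangles of `δℤ²`, the finite-volume version of Ikhlef–Ponsaing's
integrable wired/free strip), hence `¬ ParafermionPrecompact` by the landed negative lemma. The
kernel-checked compositions of this file are

  `bulkNondegenerate_of : Literature.Probability.LatticeModels.ParafermionBulkNondegenerate`
  `parafermionPrecompact_false : ¬ Theses.CardySusyWard.ParafermionPrecompact`

(no `sorry` of their own; sorries only inside the seven `stub_*`; `#h21_check_skeleton` against
`--crux-decl Literature.Probability.LatticeModels.ParafermionBulkNondegenerate` is OK). Uses: (a) the
standing disprover's missing ingredient for an unconditional kill of the typed item is precisely `H`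
(Disproof.lean "Verdict"); (b) after the tenure planner's restatement of 11293 to the edge-guarded
`C′ = ∀ D Λ, Negative.ParafermionPrecompactRepairedAt D Λ` (Disproof "Planner summary"), `H` is the
non-degeneracy input the rank-4 crux `ParafermionFamiliesToSLESix` needs (its why-fail; triage r1-2), and
this file is its construction skeleton; (c) C′ RESTRICTED to central compacts of long rectangles is the
same profile's upper bound + transverse equicontinuity — deliberately not in the composition.

## The line (seven stubs; geometry = the DIAGONAL rectangle `|x+y| < 1/2, |x−y| < A` at mesh `δ`)

* `stub_rectFamily` (construction, M–L, provable now): the explicit Dobrushin data `rectData A` (walls =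
  the two long diagonal sides, wired below / free above, split at the short-side centres at the lattice
  half-level so that no discrete tie occurs) are an admissible discretisation family of a Dobrushin
  domain, admissible below ONE mesh threshold for all aspects `A` at once.
* `stub_excursionTurning` (topological lever of the meander kernel, M, provable now): a medial dart
  trail that crosses a transverse section and returns to it, staying strictly beyond it in between,
  turns by EXACTLY `±π`, the sign being the order of the two crossing points along the section.
* `stub_rowFactorisation` (`ExcursionTurning → RowFactorisation`, M–L): the spin-1/3 passage sum at the
  centre tile is, pathwise, a function of (open-connectivity pattern of the section below, states of
  the centre row of tiles, pattern of the section above) — one kernel for all aspect ratios `A` up to a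
  unimodular constant: the finite-rank bilinear ("meander") structure `F = ⟨P⁻| 𝒦 |P⁺⟩` of the card, the
  two vectors being the UNTWISTED half-domain link-pattern laws.
* `stub_ipFirstPassage` (the integrable calibration as a NAMED LITERATURE FACT, XL to formalise, shared
  verbatim with crux stmt-11387's registered `stub_ipExact` through the landed bridge
  `stub_ipExact_of_IkhlefPonsaing`): `Literature.Probability.Percolation.IkhlefPonsaingFirstPassage`
  (IP12 Prop. 4.7: `P_{1/2}(wallConn (2m+1) b) = ipRatio m = A_V(2m+1)A_V(2m+3)/N_8(2m+2)²`, refereed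
  and published; exactly certified for `m ≤ 4` on item 11387).
* `stub_ipRatioLower` (lower Γ-asymptotics, M, provable now): `(2m+1)^{-1/3} ≤ ipRatio m` — the twin of
  the LANDED upper bound `stub_ipAsymptotic` (`Theorems/CardyComplexConeEdgePrecompactIpAsymptotic.lean`).
* `stub_stripCentreVsWall` (HARDEST, XL; the card's `StripProfileSharp`, lower half, dimensionless):
  GIVEN the factorisation, the long-rectangle (`A → ∞`) limit inferior of the centre VERTEX amplitude at
  mesh `δ` is at least `c₀ ×` the wall passage probability `P(wallConn (2m+1) b)` of a diagonal strip of
  comparable odd width `≤ 2/δ` — "bulk ≥ c₀ × boundary" in the strip, where the conserved twisted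
  current, the glide symmetry and the RS/qKZ transfer-matrix structure are available.
* `stub_rectangleToStrip` (L–XL; the card's `RectangleToStrip`): GIVEN the factorisation, a rectangle of
  fixed large aspect `A ≥ A₀(ε)` is within `ε δ^{1/3}` (from below) of that strip liminf, eventually in δ
  (uniform-in-width mixing of the two half-domain link-pattern laws).
Composition: `liminf ≥ c₀ (2m+1)^{-1/3} ≥ c₀ (2/δ)^{-1/3} = 2κ δ^{1/3}`, `‖F_A‖ ≥ κ δ^{1/3}` eventually,
`K = closedBall 0 (1/8)`, `z = centreTile` (`medialPoint δ z = δ/2`), eventually ⇒ frequently: `H`.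

Disproof.lean used: `parafermionPrecompact_iff_vanishing` / `_iff_not_bulkNondegenerate` (§3–4: the
line targets `H`, never the typed text; `parafermionPrecompact_false` is the corollary — "any refutation
must produce H" is the only `_false_without_`-type constraint on this crux, honoured at
`stub_stripCentreVsWall` + `stub_rectangleToStrip`); `resists` item 1 (forced passages only near the
marks) — the witness point is the CENTRE, marks at distance `≍ A`; item 2 (section counts give only
`max P(z∈γ) ≥ cδ`, phase uncontrolled) — the phase is tamed pathwise by the meander factorisation, the
size by the calibration; item 4 (summed vertex relations give boundary-only identities, no bulk lower
bound) — respected: the lower bound is located in the strip, where translation invariance closes the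
contour and the wall term is IP12's `P_b`, and the VERTEX statement is carried by
`stub_stripCentreVsWall`, not by an identity; §5 tightness (`medialPoint_injOn_edgeSet`) — every
observable below sits at a genuine tile (`centreTile = s(0, e₀)`). No `Theorems/ParafermionPrecompact/
Negative/*` lemma refutes an instance of a stub (both landed files imported); `ledger negatives
--problem CriticalPhenomena`: no stub is an instance (eventual-in-δ quantifiers throughout, the 0772
lesson; 0748's degenerate-arc crossing witness is unrelated to admissible Dobrushin data).
-/

noncomputable section

namespace Summit.CriticalPhenomena.CardyFormulaZ2.Cruxes.ParafermionPrecompact.RsMeanderStripProfile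

open scoped BigOperators Topology
open Filter Set MeasureTheory Metric
open Literature.Probability.LatticeModels Literature.Probability.RandomPlanarGeometry
open Literature.Probability.Percolation (BondConfig bondPercolation half openConnIn
  IkhlefPonsaingFirstPassage)
open Summit.CriticalPhenomena.CardyFormulaZ2.Theorems.ParafermionPrecompact.Negative
  (F IsFamily parafermionPrecompact_false_of_bulkNondegenerate)
open Summit.CriticalPhenomena.CardyFormulaZ2.Cruxes.EdgePrecompact.QkzStripBoundaryArm
  (diagStrip wallConn ipRatio stub_ipExact_of_IkhlefPonsaing)

set_option linter.unusedVariables false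

/-! ## Vocabulary: the diagonal Dobrushin rectangle and its discretisation family -/

/-- Longitudinal lattice position `v = x₀ − x₁` (transverse SECTIONS of the strip are the anti-diagonals
`v = const`; a TL row = the tiles between the sections `v = c` and `v = c + 1`). The transverse level is
`u = x₀ + x₁`: the walls of the diagonal strip are levels `u = const`, and a Temperley–Lieb tile = a lattice
edge joins two consecutive levels (Ikhlef–Ponsaing 2012 §2.2/§3.1; the sibling line's `diagStrip`). -/
def pos (x : Site 2) : ℤ := x 0 - x 1

/-- The open DIAGONAL RECTANGLE of aspect parameter `A`: `|x + y| < 1/2` (between the two long diagonal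
walls) and `|x − y| < A` (between the two short anti-diagonal sides); centred at `0`. At mesh `δ` its
sites are the levels `|u| < 1/(2δ)`, positions `|v| < A/δ`. -/
def diagRect (A : ℕ) : Set ℂ := {z : ℂ | |z.re + z.im| < 1 / 2 ∧ |z.re - z.im| < A}

/-- The WIRED arc at mesh `δ`: the lower long wall `x + y = −1/2` together with the lower parts
`x + y ≤ δ/2` of the two short sides. The split height `δ/2` is the lattice HALF-level `u = 1/2`, so that
no boundary site is ever equidistant from the two arcs (no tie in `zdDiscreteArc`, for every `δ`), and the
two `A`–`B` edges sit at the short-side centres, one inner face each (parity of the staircase). -/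
def lowerArc (A : ℕ) (δ : ℝ) : Set ℂ :=
  {z : ℂ | z.re + z.im = -(1 / 2) ∧ |z.re - z.im| ≤ A} ∪
    {z : ℂ | |z.re - z.im| = A ∧ -(1 / 2) ≤ z.re + z.im ∧ z.re + z.im ≤ δ / 2}

/-- The FREE (dual-wired) arc at mesh `δ`: the upper long wall `x + y = 1/2` and the upper parts
`x + y ≥ δ/2` of the short sides. -/
def upperArc (A : ℕ) (δ : ℝ) : Set ℂ :=
  {z : ℂ | z.re + z.im = 1 / 2 ∧ |z.re - z.im| ≤ A} ∪
    {z : ℂ | |z.re - z.im| = A ∧ δ / 2 ≤ z.re + z.im ∧ z.re + z.im ≤ 1 / 2}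

/-- The explicit discretisation family of the diagonal rectangle: domain `diagRect A`, mesh `δ`, wired arc
`lowerArc A δ`, free arc `upperArc A δ` (G02 Dobrushin data; the tree's `bcBondConfig` then wires the
two-level staircase along the lower wall and closes every edge at the upper one — the finite-volume
version of Ikhlef–Ponsaing's reflecting wired/free strip, up to the usual one-level offsets). -/
def rectData (A : ℕ) (δ : ℝ) : DiscreteDobrushin where
  Ω := diagRect A
  δ := δ
  arcA := lowerArc A δ
  arcB := upperArc A δ

/-- The CENTRE TILE: the lattice edge `{0, e₀}` (levels `u ∈ {0,1}`, positions `v ∈ {0,1}`), a genuine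
medial vertex with `medialPoint δ centreTile = δ/2 → 0 ∈ diagRect A`. -/
def centreTile : MedialVertex := s((0 : Site 2), Pi.single 0 1)

/-- Open-connectivity PATTERN OF THE LOWER SECTION: two sites of the section `v = 0` are related iff they
are joined by a path of `bcBondConfig`-open edges (boundary conditions imposed: wired staircase open,
free-wall edges closed) using only sites of the closed lower half `v ≤ 0`. A relation with at most
Bell(#section) values: by planarity it determines the non-crossing matching of the section's cut points by
the lower hull arcs and the position of the interface strand (the block of the wired wall) — the
"downward link pattern" of the TL transfer formalism (IP12 §3.1). -/
def lowerPattern (E : DiscreteDobrushin) (ω : BondConfig (Site 2)) : Site 2 → Site 2 → Prop :=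
  fun x y => pos x = 0 ∧ pos y = 0 ∧ E.bcBondConfig ω ∈ openConnIn {z : Site 2 | pos z ≤ 0} x y

/-- Open-connectivity PATTERN OF THE UPPER SECTION `v = 1` through the closed upper half `v ≥ 1`. -/
def upperPattern (E : DiscreteDobrushin) (ω : BondConfig (Site 2)) : Site 2 → Site 2 → Prop :=
  fun x y => pos x = 1 ∧ pos y = 1 ∧ E.bcBondConfig ω ∈ openConnIn {z : Site 2 | 1 ≤ pos z} x y

/-- The states of the CENTRE ROW of tiles: the `bcBondConfig`-open lattice edges joining the section
`v = 0` to the section `v = 1` (the row containing `centreTile`). -/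
def rowConfig (E : DiscreteDobrushin) (ω : BondConfig (Site 2)) : Set (Sym2 (Site 2)) :=
  {e | e ∈ E.bcBondConfig ω ∧ ∃ x ∈ e, ∃ y ∈ e, pos x = 0 ∧ pos y = 1}

/-! ## The two structural statements of the line (proved by stubs 2 and 3) -/

/-- **EXCURSION TURNING** (the card's `ExcursionHalfTurn`, in the TRAIL form asked by triage r1-1 and for
the transverse sections the meander uses). Let `γ` be a medial dart trail of `ℤ²` (consecutive entries are
medial darts, no dart repeated — vertices may repeat, as for the exploration path) whose first and last
entries lie on the tile level `v = c − 1/2` and all of whose other entries lie strictly beyond it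
(`v > c − 1/2`): it leaves through the section `v = c` with its first dart and comes back through it with
its last one. Then its total turning is EXACTLY a half-turn, counter-clockwise (`+π`) iff it comes back
at a larger transverse level `u` than it left, clockwise (`−π`) otherwise. (Close the excursion by the
section segment: a simple lattice circuit turns by `±2π`, the two right angles at the section absorb `π`;
darts of the oriented medial lattice of `ℤ²` never continue straight and never cross at a revisited
vertex, so the Umlaufsatz applies to trails — tree: `MedialTrailUmlaufsatz`, `MedialCycleHopf`,
`LatticeLoopWinding`; triage r1-3 E2: 68 116 excursions enumerated, 0 violations of the wall version.) -/
def ExcursionTurning : Prop :=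
  ∀ (γ : List MedialVertex) (a b : MedialVertex) (c : ℤ),
    List.IsChain IsMedialDart γ → (γ.zip γ.tail).Nodup → 3 ≤ γ.length →
    γ.head? = some a → γ.getLast? = some b →
    (medialPoint 1 a).re - (medialPoint 1 a).im = (c : ℝ) - 1 / 2 →
    (medialPoint 1 b).re - (medialPoint 1 b).im = (c : ℝ) - 1 / 2 →
    (∀ (i : ℕ) (h : i < γ.length), 0 < i → i + 1 < γ.length →
      (c : ℝ) - 1 / 2 < (medialPoint 1 γ[i]).re - (medialPoint 1 γ[i]).im) →
    Polyline.winding (γ.map (medialPoint 1)) =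
      if (medialPoint 1 a).re + (medialPoint 1 a).im < (medialPoint 1 b).re + (medialPoint 1 b).im
        then Real.pi else -Real.pi

/-- **ROW FACTORISATION** (the card's `MeanderKernel`, typed over the tree's objects). For every small
mesh there is ONE kernel `𝒦` such that for every aspect parameter `A ≥ 1` there is a unimodular constant
`θ` (the phase of the deterministic first dart at `e_a`, which depends on the parity type of the discrete
marked edge) with, for EVERY configuration `ω`,
`passageSum (medialExploration (rectData A δ) ω) δ (1/3) centreTile = θ · 𝒦 (lower pattern, centre row, upper pattern)`.
Content: the spin-1/3 vertex observable at the centre tile sees each half-rectangle only through its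
section connectivity pattern (finite rank, UNIFORM in `A`) — because (i) the exploration interface is a
strand of the fully packed loop configuration, whose passages through the centre row are fixed by the
meander of the two patterns and the row states, and (ii) by `ExcursionTurning` (and its variants for lower
excursions and for the initial strand from `e_a`) the winding at every passage is a function of that
meander. Under `P_{1/2}` the three arguments are independent, so `F = Σ P(α) P(r) P(β) θ𝒦(α,r,β)`: the
bilinear form `⟨P⁻|𝒦|P⁺⟩` in the two UNTWISTED half-domain link-pattern laws (IP12 §5: their `X_j` is the
spin-0 instance). -/
def RowFactorisation : Prop :=
  ∀ᶠ δ in 𝓝[>] (0:ℝ),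
    ∃ 𝒦 : (Site 2 → Site 2 → Prop) → Set (Sym2 (Site 2)) → (Site 2 → Site 2 → Prop) → ℂ,
      ∀ A : ℕ, 1 ≤ A → ∃ θ : ℂ, ‖θ‖ = 1 ∧ ∀ ω : BondConfig (Site 2),
        passageSum (medialExploration (rectData A δ) ω) δ (1 / 3) centreTile =
          θ * 𝒦 (lowerPattern (rectData A δ) ω) (rowConfig (rectData A δ) ω)
            (upperPattern (rectData A δ) ω)

/-! ## The stubs -/

/-- **(1) `stub_rectFamily` — the explicit family is an admissible discretisation family of a Dobrushin
domain (construction; M–L, provable now).** For every `A ≥ 1` there is a Dobrushin domain `D` (the diagonal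
rectangle `diagRect A` with marks at the two short-side centres `±(A/2)(1 − i)`, e.g.
`(rectDomain …).map` of `RectangleConformalMap.lean` / `ChordalCurveFamily.lean` rotated by `π/4`) such
that `rectData A` satisfies the six family hypotheses of the crux (`IsFamily`): `Ω`, mesh by `rfl`; arcs
within Hausdorff distance `δ` of the limiting arcs; discrete marks = midpoints of the two `A`–`B` edges,
within `O(δ)` of the short-side centres; `IsZdAdmissible` for all small `δ` — bounded, `δ > 0`, nonempty
disjoint arcs (no tie: the split is at the half-level `u = 1/2`, sites have integer level), cover (the two
arcs exhaust the frontier), exactly two `A`–`B` edges each bordering exactly one inner face (on a straight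
anti-diagonal staircase the boundary sites of the two layers have distinct levels of alternating parity, so
a half-level threshold is crossed by exactly one staircase edge per short side).
Why it might fail: only by a bookkeeping slip in the corner filaments of `meshDomain` at special meshes
(sites with one neighbour at the four right-angle tips) — they lie inside one arc and carry no inner face,
which `IsZdAdmissible` allows; repair = move the split point / shave the tips, the composition only needs
SOME admissible family of SOME Dobrushin domain containing long diagonal rectangles around `K`. Second
conjunct (used by the provers of stubs 6–7, not by the composition): admissibility holds below ONE mesh
threshold `δ₀` for ALL aspect parameters `A ≥ 1` simultaneously — the possible failure modes (ties, extra
`A`–`B` edges, face conditions) live near the two split points and the four right-angle tips, whose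
discrete types exhaust finitely many cases independent of `A`, so the liminf over `N` in stubs 6–7 never
meets junk data `medialExploration = []`. Leans on: `MedialInterface` (`zdBoundary`, `zdDiscreteArc`,
`zdABEdges`, `IsZdAdmissible`), `DomainDiscretisation` (`meshDomain`, `meshBoundary`), `PlanarDomains`
(`MarkedDomain.arc`, `pt`), `rectDomain` (`RectangleConformalMap.lean`), `JordanDomain.map` /
`MarkedDomain.map` (`ChordalCurveFamily.lean`); the general twin is route item
`DiscretisationFamilyExists` (stmt-9644). -/
theorem stub_rectFamily :
    (∀ A : ℕ, 1 ≤ A → ∃ D : DobrushinDomain, IsFamily D (rectData A)) ∧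
    (∃ δ₀ : ℝ, 0 < δ₀ ∧ ∀ A : ℕ, 1 ≤ A → ∀ δ : ℝ, 0 < δ → δ < δ₀ → (rectData A δ).IsZdAdmissible) := by
  sorry

/-- **(2) `stub_excursionTurning` — `ExcursionTurning` (topological lever; M, provable now).**
Why plausibly true: see `ExcursionTurning`; the wall version (endpoints ON a diagonal, `γ.Nodup`) was
checked by hand by all three triagers (Hopf: closing angles in `{π/4, 3π/4}`) and by brute force (r1-3 E2);
the section version here has both end darts perpendicular to the section (turning `≡ π (mod 2π)`), and
simplicity of the closed circuit follows from the trail property because the oriented medial lattice of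
`ℤ²` has no straight continuation and no crossing pairing at a vertex (the two in-darts and two out-darts
alternate). Why it might fail: a sign/orientation slip (the statement fixes: first dart = increasing `v`,
`+π` iff return at larger `u`; checked on the two minimal 4-tile excursions SE,NE,NW: `+π`, return at
`u+1`; SE,SW,NW: `−π`). Leans on: `PolylineWinding` (`Polyline.turning/winding`),
`MedialTrailUmlaufsatz` (`cturn`, `IsTrail`), `MedialCycleHopf` (`medialCycle_turning_holds`),
`LatticeLoopWinding`; `IsMedialDart`, `cornerSource/Target` (`MedialInterface`). -/
theorem stub_excursionTurning : ExcursionTurning := by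
  sorry

/-- **(3) `stub_rowFactorisation` — `ExcursionTurning → RowFactorisation` (the meander kernel exists;
M–L).** Why plausibly true: see `RowFactorisation`. Proof plan: for admissible `rectData A δ` the exploration
`γ` is unique (`existsUnique_medialExploration_holds`); split `γ` at its darts crossing the sections `v = 0`
and `v = 1`; (a) the sequence of crossings and the darts used inside the centre row are determined by the
lower/upper hull-arc matchings and the row states (planar loop bookkeeping: the matching of the section cut
points by lower arcs is the Kreweras boundary of the non-crossing partition `lowerPattern`, the wired-wall
block locating the strand from `e_a`; the free wall's dual connectivity is its complement in the simply
connected half-rectangle); (b) the turning of each excursion is `±π` by `ExcursionTurning` (upper) and its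
mirror image (lower), the turning of the initial strand from the deterministic first dart at `e_a` to its
first crossing is a constant of the half-domain (Umlaufsatz with the boundary staircase), and turning is
additive under concatenation (`Polyline.winding`), so `windingAt` at every passage through `centreTile` is a
function of (patterns, row) plus a constant `∈ (π/2)ℤ` depending on the type of `e_a` — absorbed in `θ`;
(c) inadmissible or empty data give `γ = []` and contribute through `𝒦 := 0`-compatible arguments only for
`δ` outside the eventual range. Why it might fail: if the passage phases needed the dual (free-wall)
connectivity as independent data — excluded by planarity, and repairable by enlarging the pattern (same
finite-rank content). Leans on: `MedialInterface`/`MedialInterfaceProofs` (`IsMedialExploration`,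
`existsUnique_medialExploration_holds`, `bcBondConfig`), `MedialExplorationChains`, `MedialWinding`
(`windingAt`, `passageSum`), `openConnIn`, Mathlib `SimpleGraph.Reachable`; paper: IP12 §3.1 (link
patterns), §4.1 (`⟨Ψ|ρ|Ψ⟩`), §5.1 (`X_j`). -/
theorem stub_rowFactorisation : ExcursionTurning → RowFactorisation := by
  sorry

/-- **(4) `stub_ipFirstPassage` — the integrable boundary calibration as a NAMED LITERATURE FACT (XL to
formalise; shared).** `Literature.Probability.Percolation.IkhlefPonsaingFirstPassage`: in the diagonal strip
`0 ≤ x₀+x₁ ≤ 2m+1` with the wall `x₀+x₁ = 0` wired, every site `b` of the level `2m` is joined to the wall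
inside the strip with probability EXACTLY `A_V(2m+1)A_V(2m+3)/N_8(2m+2)²` (= `ipRatio m`; Ikhlef–Ponsaing,
J. Stat. Phys. 149 (2012) 10–36 = arXiv:1202.5476, Prop. 4.7, refereed and published; `= 1, 3/4, 78/121,
247/425, 210/391, …`). Why plausibly true: it is the printed theorem, exactly certified for `m ≤ 4` by a
rational transfer-matrix computation (evidence on stmt-CriticalPhenomena-11387); by
`ikhlefPonsaingFirstPassage_iff` it is DEFINITIONALLY the registered `stub_ipExact` of line
`qkz-strip-boundary-arm` on crux 11387 (one formalisation serves both cruxes; the bridge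
`stub_ipExact_of_IkhlefPonsaing` is landed, `Theorems/CardyComplexConeEdgePrecompactIpExact.lean`). Why it
might fail: only the rigour of "transfer-matrix ground state = minimal-degree qKZ solution" (Di
Francesco–Zinn-Justin 2005 / de Gier–Pyatov 2007) behind Prop. 4.5 → 4.7; each fixed `m` is a finite
certified computation. Stated BY NAME so that it closes the moment the fact is formalised (or is carried as
the one cited hypothesis of an `H`-item). Size XL (the qKZ programme), 0 if cited. -/
theorem stub_ipFirstPassage : IkhlefPonsaingFirstPassage := by
  sorry

/-- **(5) `stub_ipRatioLower` — lower Γ-asymptotics of the ASM/CSSCPP ratio (M, provable now).**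
`(2m+1)^{-1/3} ≤ ipRatio m` for every `m` (so, with stub 4, `P(wallConn (2m+1) b) ≥ (2m+1)^{-1/3}`).
Why plausibly true / proof plan (pure real analysis, the twin of the LANDED upper bound
`stub_ipAsymptotic : ipRatio m ≤ 2(2m+1)^{-1/3}`, `Theorems/CardyComplexConeEdgePrecompactIpAsymptotic.lean`,
whose private lemmas `ipRatio_succ`, `ipRatio_zero` are to be re-derived or made public): one-step ratio
`ipRatio (m+1) = ipRatio m · N m / D m`, `N m = (3m+5)(6m+7)(4m+3)`, `D m = (3m+4)(6m+5)(4m+7)`; the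
polynomial `N(m)³(2m+3) − D(m)³(2m+1)` has the non-negative integer coefficients
`[728875, 5143775, 15679125, 26955724, 28587384, 19154304, 7920720, 1848960, 186624]` (degrees 0…8,
checked exactly in this seat), so `g m := ipRatio m ^ 3 · (2m+1)` is non-decreasing with `g 0 = 1`
(`ipRatio 0 = 1`); hence `ipRatio m ^ 3 ≥ (2m+1)^{-1}` and cube roots are monotone (`Real.rpow_natCast`,
`Real.rpow_le_rpow`). Numerically `g` = 1, 1.266, 1.339, 1.374, 1.394, 1.408 … ↑ `C_IP³ ≈ 1.47`
(IP12 Prop. 4.9). Why it might fail: it cannot (finite algebra + induction); only transcription slips. -/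
theorem stub_ipRatioLower : ∀ m : ℕ, (2 * (m : ℝ) + 1) ^ (-((1:ℝ) / 3)) ≤ ipRatio m := by
  sorry

/-- **(6) `stub_stripCentreVsWall` — bulk ≥ c₀ × boundary IN THE STRIP (HARDEST; XL; the card's
`StripProfileSharp`, lower half, dimensionless).** Given the row factorisation: there is `c₀ > 0` such that
for all small `δ` there is an odd width `2m+1 ≤ 2/δ` with
`c₀ · P(wallConn (2m+1) b) ≤ liminf_{N→∞} ‖F (rectData N) δ centreTile‖` for every `b` of the level `2m`
— the long-rectangle limit inferior of the centre VERTEX amplitude at mesh `δ` (the strip value, taken as a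
liminf of moduli so that neither the existence of the `N → ∞` limit nor the `A`-dependent phase `θ` is
presupposed) dominates the wall passage probability of a diagonal strip of comparable width (the prover
picks `m ≍ 1/(2δ)` by the true tile dictionary of the tree's `bcBondConfig` rendering: wired staircase =
levels 1–2, forced-closed column at the free wall; small `m` only makes the claim harder, `m = 0` makes it
false, so the choice is the prover's).
Why plausibly true: in the infinite wired/free diagonal strip (1) the dart observable carries a CONSERVED
longitudinal twisted current — the vertex half of discrete Cauchy–Riemann (DC 2012 Prop. 4 = route item
`CardySublatticeCoherence.HalfCRVertexRelation`, stmt-11306; tree `sum_halfCRForm_eq_halfCRFlux`) is a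
divergence condition at every tile, translation invariance along the strip and `|F| ≤ 2` close the
contour, so the twisted current through EVERY lattice line parallel to the walls is the same and equals its
value at the wired wall, `Z_T · P_b(L)` with `Z_T ≠ 0` a lattice constant (deterministic wall winding;
`|Z_T| = 1` in the normalisation of EdgePrecompact triage T3): one complex combination of the two
wall-ward dart amplitudes is pinned, hence `≥ c P_b`, at every transverse depth and in particular at the
centre, by an identity (card NOTES §3 (a); pilot: `|j| L^{1/3}` = 0.93–0.96 constant across rows); (2) the
VERTEX combination `F = (2cos(π/12))⁻¹ Σ_{4 darts}` (the sibling skeleton's `stub_fourCornerSplit`) needs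
the other real component, which no identity pins (card NOTES B4; in the zero-mode frame `G = α(1+iτū)` of
triage r1-3 the pinned combination is `2α`, the vertex sum `4κα`) — it is read off the exact bilinear form
of `RowFactorisation`: `⟨P⁻|𝒦|P⁺⟩` with `P∓` the stationary vectors of the stochastic TL(1) column chain =
RS/qKZ ground states (IP12 §3.4–3.5), whose uniform-in-`L` asymptotics relative to `P_b` (flatness of the
profile, DCS Conj. 8.7 in the strip: `φ′ ≡ const`) is the open core; Monte-Carlo (MC-pilot-ideator1, kit
j008699, axis geometry): `|F_v| L^{1/3} = 1.37–1.41` at `L = 8…128`, flat to ±3 % across the strip,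
`max|F_v|/|j| = 1.47–1.54`.
Why it might fail: exact cancellation of the four dart amplitudes in the vertex sum at the centre at
leading order (the current is then carried by a vertex-invisible mode) — contradicted by the MC ratio 1.47
at five sizes but unproved; or `L^{1/12}`-growth of the profile relative to `P_b` (kills DCS 8.7 in the
strip and the route's X2/X3 with it). Cheapest falsifier: exact ℚ(ζ₁₂) evaluation of the bilinear form
for odd `L ≤ 11` (card); before that, an MC rerun of the pilot in the DIAGONAL rectangle reporting
`‖F_v(centre)‖ / ipRatio m` at `2m+1` = 7, 15, 31 (triage r1-1 (3)). Leans on: `RowFactorisation`;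
barrier file `FKParafermionicHalfCauchyRiemann` (`halfCRForm`, `sum_halfCRForm_eq_halfCRFlux`,
`HalfCRKernel.*`), `CardySublatticeCoherence.HalfCRVertexRelation`, `BondPercolationSymmetry`
(translations), `DartPhase` (`dartPhaseSum`, `bondDartObservable`), `wallConn`; papers IP12 §§3–5, dGNP
2010 (arXiv:1004.4037, the spin-1 current computed exactly by the same qKZ technology), IWWZJ 2013
(arXiv:1302.4649 §§4–5: the observable as a conserved `U_q(sl₂^)` current). -/
theorem stub_stripCentreVsWall : RowFactorisation →
    ∃ c₀ : ℝ, 0 < c₀ ∧ ∀ᶠ δ in 𝓝[>] (0:ℝ), ∃ m : ℕ, (2 * (m : ℝ) + 1) * δ ≤ 2 ∧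
      ∀ b : Site 2, b 0 + b 1 = 2 * m →
        c₀ * (bondPercolation (zdGraph 2) half).real (wallConn (2 * m + 1) b) ≤
          Filter.liminf (fun N : ℕ => ‖F (rectData N) δ centreTile‖) atTop := by
  sorry

/-- **(7) `stub_rectangleToStrip` — a fixed long rectangle is close to the strip, uniformly in the width
(L–XL; the card's `RectangleToStrip`).** Given the row factorisation: for every `ε > 0` there is an aspect
`A₀` such that for every `A ≥ A₀`, eventually as `δ → 0⁺`,
`liminf_N ‖F (rectData N) δ centreTile‖ ≤ ‖F (rectData A) δ centreTile‖ + ε δ^{1/3}`.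
Why plausibly true: by `RowFactorisation` and independence, `F_A = θ_A Σ P_A⁻(α) P(r) P_A⁺(β) 𝒦(α,r,β)` with
the SAME bounded kernel for all `A` (`|𝒦| ≤ 2`: at most two passages per tile), so
`| |F_A| − |F_N| | ≤ 2(‖P_A⁻ − P_N⁻‖_TV + ‖P_A⁺ − P_N⁺‖_TV)`; the half-domain pattern laws are the boundary
state propagated through `≍ A/δ` columns of the stochastic TL(1) column chain on one-defect link patterns,
whose relaxation in the defect sector is `e^{-c · (columns)·δ}` per unit aspect uniformly in the width
(dynamic exponent `z = 1` of the critical transfer matrix: gap `2π x₁/L`; IP12 §5.2's power-method numerics,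
dGNP 2010); in the continuum the statement is `φ′_A(0)/φ′_∞(0) → 1` exponentially in `A` (DCS Conj. 8.7
scale). The needed precision `ε δ^{1/3}` (relative, not absolute) is the whole difficulty: TV-mixing of the
full pattern law at rate uniform in `L` is stronger than needed and may fail by `log L` prefactors; the
intended proof controls only the `𝒦`-weighted difference (spectral decomposition of the column transfer
matrix restricted to the observable, or an RSW coupling of the two half-domain configurations beyond
distance `A₀·width` conditioned on the centre meander — scale-invariant RSW on `ℤ²` makes the coupling
error `e^{-cA₀}` uniformly in `δ`). Why it might fail: mixing time of the defect position `≫ L` columns (a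
slow mode) — no evidence; MC profiles at aspect 8 are already flat and `L`-stable. Leans on:
`RowFactorisation`, `bondPercolation` product structure (`Percolation.lean`), ℤ² RSW
(`KohlerSchindlerTassionRSW`, `ZdGeneralRSW`, `AnnulusCircuits`) for the coupling road; no transfer-matrix
library exists (paper-only: IP12, dGNP 2010, de Gier–Pyatov 2007). -/
theorem stub_rectangleToStrip : RowFactorisation →
    ∀ ε : ℝ, 0 < ε → ∃ A₀ : ℕ, 1 ≤ A₀ ∧ ∀ A : ℕ, A₀ ≤ A → ∀ᶠ δ in 𝓝[>] (0:ℝ),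
      Filter.liminf (fun N : ℕ => ‖F (rectData N) δ centreTile‖) atTop ≤
        ‖F (rectData A) δ centreTile‖ + ε * δ ^ ((1:ℝ) / 3) := by
  sorry

/-! ## Proved glue -/

/-- **Wall calibration, lower half** (from stubs 4 + 5 and the landed bridge
`stub_ipExact_of_IkhlefPonsaing`): `P_{1/2}(wallConn (2m+1) b) ≥ (2m+1)^{-1/3}` for `b` on the level `2m`.
This is gen 1's `stub_wallPassageLower` with `c = 1`, now glue. -/
theorem wallPassage_lower (m : ℕ) (b : Site 2) (hb : b 0 + b 1 = 2 * m) :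
    (2 * (m : ℝ) + 1) ^ (-((1:ℝ) / 3)) ≤
      (bondPercolation (zdGraph 2) half).real (wallConn (2 * m + 1) b) := by
  rw [stub_ipExact_of_IkhlefPonsaing stub_ipFirstPassage m b hb]
  exact stub_ipRatioLower m

/-- `(2/δ)^{-1/3} = 2^{-1/3} δ^{1/3}` for `δ > 0`. -/
theorem rpow_two_div (δ : ℝ) (hδ : 0 < δ) :
    (2 / δ) ^ (-((1:ℝ) / 3)) = (2:ℝ) ^ (-((1:ℝ) / 3)) * δ ^ ((1:ℝ) / 3) := by
  rw [div_eq_mul_inv, Real.mul_rpow (by norm_num) (inv_nonneg.2 hδ.le), Real.inv_rpow hδ.le,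
    Real.rpow_neg hδ.le, inv_inv]

/-- The compact `K` of the witness lies in the rectangle: `closedBall 0 (1/8) ⊆ diagRect A` for `A ≥ 1`. -/
theorem closedBall_subset_diagRect (A : ℕ) (hA : 1 ≤ A) :
    closedBall (0:ℂ) (1 / 8) ⊆ diagRect A := by
  intro z hz
  rw [mem_closedBall, dist_zero_right] at hz
  have hre : |z.re| ≤ 1 / 8 := (Complex.abs_re_le_norm z).trans hz
  have him : |z.im| ≤ 1 / 8 := (Complex.abs_im_le_norm z).trans hz
  have hA' : (1:ℝ) ≤ (A:ℝ) := by exact_mod_cast hA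
  rw [abs_le] at hre him
  refine ⟨abs_lt.2 ⟨by linarith, by linarith⟩, abs_lt.2 ⟨by linarith, by linarith⟩⟩

/-- The observed point: `medialPoint δ centreTile = δ/2`. -/
theorem medialPoint_centreTile (δ : ℝ) : medialPoint δ centreTile = ((δ / 2 : ℝ) : ℂ) := by
  apply Complex.ext
  · simp [centreTile, medialPoint_mk, meshPoint_re]
  · simp [centreTile, medialPoint_mk, meshPoint_im]

/-- For `0 < δ < 1/4` the observed point lies in `K = closedBall 0 (1/8)`. -/
theorem medialPoint_centreTile_mem (δ : ℝ) (hδ : 0 < δ) (hδ' : δ < 1 / 4) :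
    medialPoint δ centreTile ∈ closedBall (0:ℂ) (1 / 8) := by
  rw [medialPoint_centreTile, mem_closedBall, dist_zero_right, Complex.norm_real, Real.norm_eq_abs,
    abs_of_pos (by positivity)]
  linarith

/-! ## The compositions (kernel-checked, no `sorry` of their own) -/

/-- **`H` from the seven stubs** (the audited skeleton theorem: concludes
`Literature.Probability.LatticeModels.ParafermionBulkNondegenerate` BY NAME). Strip lower bound (6) +
calibration (4,5): eventually in `δ`, `liminf_N ‖F_N(δ)‖ ≥ c₀ (2m+1)^{-1/3} ≥ c₀ (2/δ)^{-1/3} = 2κ δ^{1/3}`;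
comparison (7) at `ε = κ` with `A = A₀(κ)`: `‖F (rectData A₀) δ centreTile‖ ≥ κ δ^{1/3} > (κ/2) δ^{1/3}`;
family (1) supplies the Dobrushin domain; `K = closedBall 0 (1/8) ⊆ D` is compact and contains
`medialPoint δ centreTile = δ/2`; eventually ⇒ frequently along `𝓝[>] 0`. The factorisation hypothesis of
(6)/(7) is discharged by (3)∘(2). -/
theorem bulkNondegenerate_of : ParafermionBulkNondegenerate := by
  have hRF : RowFactorisation := stub_rowFactorisation stub_excursionTurning
  obtain ⟨c₀, hc₀, hstrip⟩ := stub_stripCentreVsWall hRF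
  set κ : ℝ := c₀ * (2:ℝ) ^ (-((1:ℝ) / 3)) / 2 with hκ
  have h2pow : 0 < (2:ℝ) ^ (-((1:ℝ) / 3)) := Real.rpow_pos_of_pos (by norm_num) _
  have hκpos : 0 < κ := by positivity
  obtain ⟨A₀, hA₀, hcomp⟩ := stub_rectangleToStrip hRF κ hκpos
  obtain ⟨D, hFam⟩ := stub_rectFamily.1 A₀ hA₀
  have hKD : closedBall (0:ℂ) (1 / 8) ⊆ D.carrier := by
    rw [← hFam.1 0]
    exact closedBall_subset_diagRect A₀ hA₀
  refine ⟨D, rectData A₀, hFam, closedBall (0:ℂ) (1 / 8), isCompact_closedBall _ _, hKD, κ / 2,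
    by positivity, ?_⟩
  have hpos : ∀ᶠ δ in 𝓝[>] (0:ℝ), 0 < δ := self_mem_nhdsWithin
  have hsmall : ∀ᶠ δ in 𝓝[>] (0:ℝ), δ < 1 / 4 := by
    have : Iio (1 / 4 : ℝ) ∈ 𝓝 (0:ℝ) := Iio_mem_nhds (by norm_num)
    exact mem_nhdsWithin_of_mem_nhds this
  refine Filter.Eventually.frequently ?_
  filter_upwards [hstrip, hcomp A₀ le_rfl, hpos, hsmall] with δ hsδ hcδ hδ0 hδ4
  obtain ⟨m, hmδ, hm⟩ := hsδ
  refine ⟨centreTile, medialPoint_centreTile_mem δ hδ0 hδ4, ?_⟩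
  -- a site of the level 2m
  let b : Site 2 := ![(2 * m : ℤ), 0]
  have hbsum : b 0 + b 1 = 2 * m := by simp [b]
  have h1 : c₀ * (bondPercolation (zdGraph 2) half).real (wallConn (2 * m + 1) b) ≤
      Filter.liminf (fun N : ℕ => ‖F (rectData N) δ centreTile‖) atTop := hm b hbsum
  have h2 : (2 * (m : ℝ) + 1) ^ (-((1:ℝ) / 3)) ≤
      (bondPercolation (zdGraph 2) half).real (wallConn (2 * m + 1) b) := wallPassage_lower m b hbsum
  -- (2m+1)^{-1/3} ≥ (2/δ)^{-1/3} = 2^{-1/3} δ^{1/3}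
  have hLpos : (0:ℝ) < 2 * (m : ℝ) + 1 := by positivity
  have hle : 2 * (m : ℝ) + 1 ≤ 2 / δ := by
    rw [le_div_iff₀ hδ0]; exact hmδ
  have hexp : (-((1:ℝ) / 3)) ≤ 0 := by norm_num
  have h3 : (2 / δ) ^ (-((1:ℝ) / 3)) ≤ (2 * (m : ℝ) + 1) ^ (-((1:ℝ) / 3)) :=
    Real.rpow_le_rpow_of_nonpos hLpos hle hexp
  rw [rpow_two_div δ hδ0] at h3
  have hδpow : 0 < δ ^ ((1:ℝ) / 3) := Real.rpow_pos_of_pos hδ0 _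
  -- chain: liminf ≥ c₀ 2^{-1/3} δ^{1/3} = 2κ δ^{1/3}
  have h4 : 2 * κ * δ ^ ((1:ℝ) / 3) ≤
      Filter.liminf (fun N : ℕ => ‖F (rectData N) δ centreTile‖) atTop := by
    have e1 : 2 * κ * δ ^ ((1:ℝ) / 3) = c₀ * ((2:ℝ) ^ (-((1:ℝ) / 3)) * δ ^ ((1:ℝ) / 3)) := by
      rw [hκ]; ring
    rw [e1]
    calc c₀ * ((2:ℝ) ^ (-((1:ℝ) / 3)) * δ ^ ((1:ℝ) / 3))
        ≤ c₀ * (2 * (m : ℝ) + 1) ^ (-((1:ℝ) / 3)) := mul_le_mul_of_nonneg_left h3 hc₀.le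
      _ ≤ c₀ * (bondPercolation (zdGraph 2) half).real (wallConn (2 * m + 1) b) :=
          mul_le_mul_of_nonneg_left h2 hc₀.le
      _ ≤ _ := h1
  have h5 : κ * δ ^ ((1:ℝ) / 3) ≤ ‖F (rectData A₀) δ centreTile‖ := by linarith [h4, hcδ]
  have h6 : κ / 2 * δ ^ ((1:ℝ) / 3) < κ * δ ^ ((1:ℝ) / 3) := by nlinarith
  exact h6.trans_le h5

/-- **The typed crux is FALSE** (modulo the seven stubs): `H → ¬ ParafermionPrecompact` is the landed
negative lemma `Negative.parafermionPrecompact_false_of_bulkNondegenerate` (p74235). Proving the stubs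
closes item stmt-CriticalPhenomena-11293 as `refuted` (class misstated; repaired statement = the
edge-guarded `C′`), and `H` is then the non-degeneracy hypothesis the route's X3 needs. -/
theorem parafermionPrecompact_false : ¬ Theses.CardySusyWard.ParafermionPrecompact :=
  parafermionPrecompact_false_of_bulkNondegenerate bulkNondegenerate_of

end Summit.CriticalPhenomena.CardyFormulaZ2.Cruxes.ParafermionPrecompact.RsMeanderStripProfile

end
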